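import Mathlib
import Literature.AlgebraicGeometry.Resolution.CobordantGame
import Literature.AlgebraicGeometry.Resolution.CobordantChartCoefficients
import Literature.AlgebraicGeometry.Resolution.CobordantChartPlaneSlice

/-!
# `LocalWeightedDrop`: the slice of a successor is the transform under the RESTRICTED chart

Route `ResolutionOfSingularities/WeightedInvariant`, crux `LocalWeightedDrop` (stmt-ResolutionOfSingularities-8899), line
`hasse-ridge-face-selection` (chain w43, [OURS · L1 W4.3]); bridge (a) of the S2/S3 attack plan.  For the cobordant chart
`x_l ↦ s^{w_l}(c_l + y_l)` with `f(chart) = sᵃ · G`, the slice `Sl = G|_{y_i = 0}` (an `(n+1)`-variable germ in `s` and the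
`y_l`, `l ≠ i`) satisfies `f(restricted chart) = sᵃ · Sl` for the RESTRICTED chart `x_i ↦ s^{w_i} c_i`,
`x_l ↦ s^{w_l}(c_l + y_l)` (`l ≠ i`) — a substitution in the SAME number of variables.  For weights in `{0, 1}` these are
the classical affine charts of point and curve blow-ups translated to the exceptional point, i.e. the ring maps of the
characteristic-polygon files (`PolygonChartTransport`, `ChartTwoPolygonLaws`, `CurveBlowupPolygonLaws`) on `k[[y, u₁, u₂]]`.
* `subst_slice_chart` — the components of the restricted chart as slices of the chart components;
* `subst_restrictedChart` — `f(restricted chart) = sᵃ · Sl`.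
-/

set_option linter.dupNamespace false -- mandated namespace of this single-conjunct summit

namespace Summit.ResolutionOfSingularities.ResolutionOfSingularities.Theorems

open Literature.AlgebraicGeometry.Resolution

namespace SliceChart

variable {k : Type} [Field k] {n : ℕ}

/-- Slicing the chart component `s^{w_l}(c_l + y_l)` at `y_i = 0` gives the restricted chart component. -/
theorem subst_slice_chart (w : Fin (n + 1) → ℕ) (c : Fin (n + 1) → k) (i l : Fin (n + 1)) :
    MvPowerSeries.subst (fun j : Fin (n + 2) => if j = i.succ then (0 : MvPowerSeries (Fin (n + 1)) k)
        else MvPowerSeries.X (Fin.predAbove i j)) (CobordantChart.chart w c l) =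
      MvPowerSeries.X 0 ^ (w l) * (MvPowerSeries.C (c l) +
        if l = i then (0 : MvPowerSeries (Fin (n + 1)) k) else MvPowerSeries.X (Fin.predAbove i l.succ)) := by
  have hσ := CobordantChartPlaneSlice.hasSubst_slice (R := k) i
  rw [CobordantChart.chart_apply, ← MvPowerSeries.coe_substAlgHom hσ, map_mul, map_pow, map_add,
    MvPowerSeries.substAlgHom_X, MvPowerSeries.substAlgHom_X, MvPowerSeries.coe_substAlgHom, MvPowerSeries.subst_C]
  have h0 : (0 : Fin (n + 2)) ≠ i.succ := (Fin.succ_ne_zero i).symm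
  simp only [h0, if_false, Fin.predAbove_right_zero]
  by_cases hl : l = i
  · subst hl
    simp
  · rw [if_neg (fun h => hl (Fin.succ_inj.mp h)), if_neg hl]

/-- THE SLICE IS THE TRANSFORM UNDER THE RESTRICTED CHART: if `f(x ↦ s^{w}(c + y)) = sᵃ · G`, then substituting
`x_i ↦ s^{w_i} c_i`, `x_l ↦ s^{w_l}(c_l + y_l)` (`l ≠ i`, with `y_l` renumbered by `Fin.predAbove i`) into `f` gives
`sᵃ · G|_{y_i = 0}`. -/
theorem subst_restrictedChart (w : Fin (n + 1) → ℕ) (c : Fin (n + 1) → k) (hc : ∀ l, w l = 0 → c l = 0)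
    (f : MvPowerSeries (Fin (n + 1)) k) (a : ℕ) (G : MvPowerSeries (Fin (n + 2)) k)
    (hfac : MvPowerSeries.subst (CobordantChart.chart w c) f = MvPowerSeries.X 0 ^ a * G) (i : Fin (n + 1)) :
    MvPowerSeries.subst (fun l : Fin (n + 1) => MvPowerSeries.X 0 ^ (w l) * (MvPowerSeries.C (c l) +
        if l = i then (0 : MvPowerSeries (Fin (n + 1)) k) else MvPowerSeries.X (Fin.predAbove i l.succ))) f =
      MvPowerSeries.X 0 ^ a * MvPowerSeries.subst (fun j : Fin (n + 2) => if j = i.succ then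
        (0 : MvPowerSeries (Fin (n + 1)) k) else MvPowerSeries.X (Fin.predAbove i j)) G := by
  have hσ := CobordantChartPlaneSlice.hasSubst_slice (R := k) i
  have hch := CobordantChart.hasSubst_chart w c hc
  have hfam : (fun l : Fin (n + 1) => MvPowerSeries.X 0 ^ (w l) * (MvPowerSeries.C (c l) +
      if l = i then (0 : MvPowerSeries (Fin (n + 1)) k) else MvPowerSeries.X (Fin.predAbove i l.succ))) =
      fun l => MvPowerSeries.subst (fun j : Fin (n + 2) => if j = i.succ then (0 : MvPowerSeries (Fin (n + 1)) k)
        else MvPowerSeries.X (Fin.predAbove i j)) (CobordantChart.chart w c l) :=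
    funext fun l => (subst_slice_chart w c i l).symm
  have h0 : (0 : Fin (n + 2)) ≠ i.succ := (Fin.succ_ne_zero i).symm
  rw [hfam, ← MvPowerSeries.subst_comp_subst_apply hch hσ, hfac, MvPowerSeries.subst_mul hσ,
    MvPowerSeries.subst_pow hσ, MvPowerSeries.subst_X hσ]
  simp only [h0, if_false, Fin.predAbove_right_zero]

/-- A germ is a singular successor at `c` iff its slice data say so; recorded as the trivial repackaging
`IsSuccessor f X w G → (∃ c a, (∃ i, 0 < w i ∧ c i ≠ 0) ∧ subst (chart w c') f = sᵃ·G ∧ s ∤ G)` with the crux's point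
`c' = (c_i if w_i > 0 else 0)`, for use with `subst_restrictedChart`. -/
theorem exists_chart_of_isSuccessor {f : MvPowerSeries (Fin (n + 1)) k} {w : Fin (n + 1) → ℕ}
    {G : MvPowerSeries (Fin (n + 2)) k}
    (hG : CobordantGame.IsSuccessor k f (MvPowerSeries.X : Fin (n + 1) → MvPowerSeries (Fin (n + 1)) k) w G) :
    ∃ (c : Fin (n + 1) → k) (a : ℕ), (∃ i, 0 < w i ∧ c i ≠ 0) ∧ (∀ l, w l = 0 → c l = 0) ∧
      MvPowerSeries.subst (CobordantChart.chart w c) f = MvPowerSeries.X 0 ^ a * G ∧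
      ¬ (MvPowerSeries.X (0 : Fin (n + 2)) ∣ G) := by
  obtain ⟨c, a, ⟨i, hwi, hci⟩, hfac, hndvd, -⟩ := hG
  have hself : MvPowerSeries.subst (MvPowerSeries.X : Fin (n + 1) → MvPowerSeries (Fin (n + 1)) k) f = f := by
    rw [MvPowerSeries.subst_self]; rfl
  have hchart : CobordantGame.cruxChart k w c = CobordantChart.chart w (fun l => if 0 < w l then c l else 0) :=
    CobordantChart.cruxChart_eq_chart w c
  rw [hchart, hself] at hfac
  refine ⟨fun l => if 0 < w l then c l else 0, a, ⟨i, hwi, by simpa [hwi] using hci⟩, fun l hl => ?_, hfac, hndvd⟩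
  simp [hl]

end SliceChart

end Summit.ResolutionOfSingularities.ResolutionOfSingularities.Theorems
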